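import Mathlib
import HarnessLib
import Summits.Parity.GeneralizedHardyLittlewood.Theorems.DilatedChowla.Negative.DilatedChowlaMirrorOnePointDefs
import Literature.NumberTheory.LFunctions.MoebiusCharacterSumData
import Literature.NumberTheory.LFunctions.MoebiusCharacterSumBoundProofs
import Literature.NumberTheory.LFunctions.LandauPageRealZeros
import Literature.NumberTheory.LFunctions.DirichletLFunctionZeroFreeRegion
import Literature.NumberTheory.LFunctions.PageUniformPNT

/-!
# `DilatedChowla` (stmt-Parity-13319): the non-exceptional Möbius law of the mirror line

Part of the analytic stub of the line `Sketch` (card `siegel-mirror`) for the crux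
`LiouvilleMAD.DilatedChowla`.  This file proves `moebiusNonexcLaw`:
there are absolute `c₁, C₁ > 0` with `MoebiusNonexcLaw c₁ C₁`, i.e. whenever a real character
`ψ ≠ 1 mod k` owns a real zero `β ∈ (1 − c₁/log(4k), 1)` of `L(s, ψ)`, every OTHER character
`Ξ mod k` has tiny twisted Möbius sums, `‖Mtw Ξ x‖ ≤ x/k⁶` for `x ≥ exp(C₁ (1 + log k)²)`.

The argument (Montgomery–Vaughan §11.3, Exercises 7–8, in the tree):

* the Landau engine with an exceptional zero, `ExcPsiData.exists_psi_bound`, applied to the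
  non-negative sequences `1 + λ Re(w Ξ(n)) μ(n)` (`MoebiusTwist.exists_excPsiData_all`,
  `MoebiusTwist.psi_coeff_eq`), gives for `x ≥ 64`, `log k ≤ √log x` and `|w| ≤ 1`
  `|⌊x⌋ + λ Re(w M) − x + α x^{β'}/β'| ≤ A (C₀ k² + 1) x e^{−(c/80)√log x}`, `M = Mtw Ξ x`,
  `1/λ = K log 4k + 1`;
* the possible residue term has `α = 0` unless `Ξ ≠ 1` is quadratic with the real zero `β'`; in the
  latter case, since `Ξ ≠ ψ`, Landau's same-level repulsion
  (`DirichletZFR.exists_landau_sameLevel_min_le`) gives `min(β', β) ≤ 1 − c_L/log 4k`, and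
  `β > 1 − (c_L/2)/log 4k` forces `β' ≤ 1 − c_L/log 4k`, so `|α x^{β'}/β'| ≤ 2 x e^{−c_L log x/log 4k}`;
* `w = 1` and `w = −i` give `Re M` and `Im M` (`mnon_re_bound`);
* finally, for `log x ≥ C₁ (1 + log k)²` with `C₁` large in terms of the absolute constants,
  each of the three resulting terms is at most `x/(3k⁶)` (`mnon_constants`, elementary).

Main result: `moebiusNonexcLaw`.
-/

noncomputable section

namespace Summit.Parity.GeneralizedHardyLittlewood.Theorems.DilatedChowla.Negative

open Finset Complex
open Literature.NumberTheory.LFunctions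
open scoped ArithmeticFunction.Moebius

/-! ## §1 Elementary inequalities for the choice of `C₁` -/

/-- `M ≤ exp(M u)` for `0 ≤ M`, `1 ≤ u`. -/
theorem mnon_le_exp_mul {M u : ℝ} (hM : 0 ≤ M) (hu : 1 ≤ u) : M ≤ Real.exp (M * u) := by
  calc M ≤ M + 1 := by linarith
    _ ≤ Real.exp M := Real.add_one_le_exp M
    _ ≤ Real.exp (M * u) := Real.exp_le_exp.2 (by nlinarith)

/-- Absorption: `M e^{n u} e^{−t u} ≤ 1` when `0 ≤ M`, `1 ≤ u` and `M + n ≤ t`. -/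
theorem mnon_absorb {M n t u : ℝ} (hM : 0 ≤ M) (hu : 1 ≤ u) (h : M + n ≤ t) :
    M * Real.exp (n * u) * Real.exp (-(t * u)) ≤ 1 := by
  have h1 := mnon_le_exp_mul hM hu
  calc M * Real.exp (n * u) * Real.exp (-(t * u))
      ≤ Real.exp (M * u) * Real.exp (n * u) * Real.exp (-(t * u)) := by gcongr
    _ = Real.exp ((M + n - t) * u) := by rw [← Real.exp_add, ← Real.exp_add]; ring_nf
    _ ≤ Real.exp 0 := Real.exp_le_exp.2 (by nlinarith)
    _ = 1 := Real.exp_zero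

/-- Growth: `M e^{n u} ≤ x` when `0 ≤ M`, `0 ≤ n`, `1 ≤ u`, `M + n ≤ C₁` and `exp(C₁ u²) ≤ x`. -/
theorem mnon_growth {M n C₁ u x : ℝ} (hM : 0 ≤ M) (hn : 0 ≤ n) (hu : 1 ≤ u) (h : M + n ≤ C₁)
    (hx : Real.exp (C₁ * u ^ 2) ≤ x) : M * Real.exp (n * u) ≤ x := by
  have h1 := mnon_le_exp_mul hM hu
  have hu2 : u ≤ u ^ 2 := by nlinarith
  have hC : 0 ≤ C₁ := by linarith
  have h2 : (M + n) * u ≤ C₁ * u ^ 2 :=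
    calc (M + n) * u ≤ C₁ * u := mul_le_mul_of_nonneg_right h (by linarith)
      _ ≤ C₁ * u ^ 2 := mul_le_mul_of_nonneg_left hu2 hC
  calc M * Real.exp (n * u) ≤ Real.exp (M * u) * Real.exp (n * u) := by gcongr
    _ = Real.exp ((M + n) * u) := by rw [← Real.exp_add]; ring_nf
    _ ≤ Real.exp (C₁ * u ^ 2) := Real.exp_le_exp.2 h2
    _ ≤ x := hx

/-- `k ^ n ≤ exp(n (1 + log k))` for real `k ≥ 1`. -/
theorem mnon_pow_le_exp {k : ℝ} (hk : 1 ≤ k) (n : ℕ) :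
    k ^ n ≤ Real.exp (n * (1 + Real.log k)) := by
  have hk0 : 0 < k := by linarith
  have hn : (0 : ℝ) ≤ n := n.cast_nonneg
  calc k ^ n = Real.exp (Real.log k) ^ n := by rw [Real.exp_log hk0]
    _ = Real.exp (n * Real.log k) := (Real.exp_nat_mul _ _).symm
    _ ≤ Real.exp (n * (1 + Real.log k)) := Real.exp_le_exp.2 (by nlinarith)

/-- `K (log k + log 4) + 1 ≤ (3K + 1) exp(1 + log k)` for real `k ≥ 1`, `K ≥ 0`. -/
theorem mnon_P_le {K k : ℝ} (hK : 0 ≤ K) (hk : 1 ≤ k) :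
    K * (Real.log k + Real.log 4) + 1 ≤ (3 * K + 1) * Real.exp (1 + Real.log k) := by
  have hlog4 := PageUniformPNT.log_four_le_three
  have hlogk : 0 ≤ Real.log k := Real.log_nonneg hk
  have hu : 1 + Real.log k ≤ Real.exp (1 + Real.log k) := by
    linarith [Real.add_one_le_exp (1 + Real.log k)]
  have h1 : Real.log k + Real.log 4 ≤ 3 * (1 + Real.log k) := by linarith
  calc K * (Real.log k + Real.log 4) + 1 ≤ K * (3 * (1 + Real.log k)) + 1 * (1 + Real.log k) := by
        nlinarith
    _ = (3 * K + 1) * (1 + Real.log k) := by ring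
    _ ≤ (3 * K + 1) * Real.exp (1 + Real.log k) := mul_le_mul_of_nonneg_left hu (by positivity)

/-- **The choice of `C₁`.**  Given the absolute constants `c, c_L > 0`, `K, A₀, C₀ ≥ 0` of the
analytic input, there is `C₁ > 0` such that for every real `k ≥ 1` and every
`x ≥ exp(C₁ (1 + log k)²)`: `x ≥ 64`, `log k ≤ √log x`, and
`2 (K log 4k + 1) (A₀ (C₀ k² + 1) x e^{−(c/80)√log x} + 1 + 2 x e^{−c_L log x/log 4k}) ≤ x/k⁶`. -/
theorem mnon_constants {c cL K A₀ C₀ : ℝ} (hc : 0 < c) (hcL : 0 < cL) (hK : 0 ≤ K)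
    (hA₀ : 0 ≤ A₀) (hC₀ : 0 ≤ C₀) :
    ∃ C₁ : ℝ, 0 < C₁ ∧ ∀ k : ℝ, 1 ≤ k → ∀ x : ℝ, Real.exp (C₁ * (1 + Real.log k) ^ 2) ≤ x →
      64 ≤ x ∧ Real.log k ≤ Real.sqrt (Real.log x) ∧
        2 * (K * (Real.log k + Real.log 4) + 1) *
          (A₀ * (C₀ * k ^ 2 + 1) * x * Real.exp (-(c / 80 * Real.sqrt (Real.log x))) + 1 +
            2 * x * Real.exp (-(cL / (Real.log k + Real.log 4) * Real.log x))) ≤ x / k ^ 6 := by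
  -- one master constant `M` dominating the three numerical factors
  set M : ℝ := 12 * (3 * K + 1) * (A₀ + 1) * (C₀ + 1) with hM
  have hKA : 0 ≤ K * A₀ := mul_nonneg hK hA₀
  have hKC : 0 ≤ K * C₀ := mul_nonneg hK hC₀
  have hAC : 0 ≤ A₀ * C₀ := mul_nonneg hA₀ hC₀
  have hKAC : 0 ≤ K * A₀ * C₀ := mul_nonneg hKA hC₀
  have hM0 : 0 ≤ M := by positivity
  have hM1 : 12 * (3 * K + 1) ≤ M := by rw [hM]; linarith
  have hM2 : 6 * (3 * K + 1) * A₀ * (C₀ + 1) ≤ M := by rw [hM]; linarith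
  have hM3 : 6 * (3 * K + 1) ≤ M := by linarith
  set C₁ : ℝ := (80 * (M + 9) / c) ^ 2 + 3 * (M + 9) / cL + (M + 9) with hC₁
  have hsq0 : 0 ≤ (80 * (M + 9) / c) ^ 2 := sq_nonneg _
  have hdiv0 : 0 ≤ 3 * (M + 9) / cL := by positivity
  have hC₁a : (80 * (M + 9) / c) ^ 2 ≤ C₁ := by rw [hC₁]; linarith
  have hC₁b : 3 * (M + 9) / cL ≤ C₁ := by rw [hC₁]; linarith
  have hC₁c : M + 9 ≤ C₁ := by rw [hC₁]; linarith
  have hC₁0 : 0 < C₁ := by linarith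
  -- the two exponents
  have hsqrtC : 80 * (M + 9) / c ≤ Real.sqrt C₁ := (Real.le_sqrt (by positivity) hC₁0.le).2 hC₁a
  have h1C : 1 ≤ Real.sqrt C₁ := by
    rw [← Real.sqrt_one]; exact Real.sqrt_le_sqrt (by linarith)
  have ht1 : M + 9 ≤ c / 80 * Real.sqrt C₁ := by
    rw [div_le_iff₀ hc] at hsqrtC; linarith
  have ht3 : M + 9 ≤ cL * C₁ / 3 := by
    have h := hC₁b
    rw [div_le_iff₀ hcL] at h; linarith
  refine ⟨C₁, hC₁0, fun k hk x hx ↦ ?_⟩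
  have hk0 : 0 < k := by linarith
  have hlogk0 : 0 ≤ Real.log k := Real.log_nonneg hk
  set u : ℝ := 1 + Real.log k with hu
  have hu1 : 1 ≤ u := by linarith
  have hx0 : 0 < x := (Real.exp_pos _).trans_le hx
  set L : ℝ := Real.log x with hL
  have hLC : C₁ * u ^ 2 ≤ L := by
    have := Real.log_le_log (Real.exp_pos _) hx
    rwa [Real.log_exp] at this
  have hu2 : 1 ≤ u ^ 2 := one_le_pow₀ hu1
  have hL9 : 9 ≤ L := by
    have : 9 * 1 ≤ C₁ * u ^ 2 := mul_le_mul (by linarith) hu2 zero_le_one hC₁0.le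
    linarith
  have hx64 : 64 ≤ x := by
    calc (64 : ℝ) ≤ Real.exp 5 := MoebiusTwist.sixtyfour_le_exp_five
      _ ≤ Real.exp L := Real.exp_le_exp.2 (by linarith)
      _ = x := by rw [hL, Real.exp_log hx0]
  have hsqrtL : Real.sqrt C₁ * u ≤ Real.sqrt L := by
    calc Real.sqrt C₁ * u = Real.sqrt (C₁ * u ^ 2) := by
          rw [Real.sqrt_mul hC₁0.le, Real.sqrt_sq (by linarith)]
      _ ≤ Real.sqrt L := Real.sqrt_le_sqrt hLC
  have hlogk : Real.log k ≤ Real.sqrt L := by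
    calc Real.log k ≤ u := by linarith
      _ ≤ Real.sqrt C₁ * u := le_mul_of_one_le_left (by linarith) h1C
      _ ≤ Real.sqrt L := hsqrtL
  refine ⟨hx64, hlogk, ?_⟩
  -- sizes of the factors
  have hlog40 : 0 < Real.log 4 := Real.log_pos (by norm_num)
  set ℒ₀ : ℝ := Real.log k + Real.log 4 with hℒ₀
  have hℒ₀0 : 0 < ℒ₀ := by positivity
  have hℒ₀u : ℒ₀ ≤ 3 * u := by have := PageUniformPNT.log_four_le_three; linarith
  set P : ℝ := K * ℒ₀ + 1 with hP
  have hP0 : 0 < P := by positivity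
  have hPle : P ≤ (3 * K + 1) * Real.exp u := mnon_P_le hK hk
  have hk2 : k ^ 2 ≤ Real.exp (2 * u) := by exact_mod_cast mnon_pow_le_exp hk 2
  have hk6 : k ^ 6 ≤ Real.exp (6 * u) := by exact_mod_cast mnon_pow_le_exp hk 6
  have hCk : C₀ * k ^ 2 + 1 ≤ (C₀ + 1) * Real.exp (2 * u) := by
    have h1 : (1 : ℝ) ≤ k ^ 2 := one_le_pow₀ hk
    have h2 : C₀ * k ^ 2 ≤ C₀ * Real.exp (2 * u) := mul_le_mul_of_nonneg_left hk2 hC₀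
    linarith
  set E : ℝ := Real.exp (-(c / 80 * Real.sqrt L)) with hE
  set EL : ℝ := Real.exp (-(cL / ℒ₀ * L)) with hEL
  have hE0 : 0 < E := Real.exp_pos _
  have hEL0 : 0 < EL := Real.exp_pos _
  have hEle : E ≤ Real.exp (-(c / 80 * Real.sqrt C₁ * u)) := by
    refine Real.exp_le_exp.2 (neg_le_neg ?_)
    calc c / 80 * Real.sqrt C₁ * u = c / 80 * (Real.sqrt C₁ * u) := by ring
      _ ≤ c / 80 * Real.sqrt L := mul_le_mul_of_nonneg_left hsqrtL (by positivity)
  have hELle : EL ≤ Real.exp (-(cL * C₁ / 3 * u)) := by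
    refine Real.exp_le_exp.2 (neg_le_neg ?_)
    have h1 : cL * C₁ / 3 * u * ℒ₀ ≤ cL * L := by
      calc cL * C₁ / 3 * u * ℒ₀ ≤ cL * C₁ / 3 * u * (3 * u) :=
            mul_le_mul_of_nonneg_left hℒ₀u (by positivity)
        _ = cL * (C₁ * u ^ 2) := by ring
        _ ≤ cL * L := mul_le_mul_of_nonneg_left hLC hcL.le
    have h2 : cL / ℒ₀ * L = cL * L / ℒ₀ := div_mul_eq_mul_div cL ℒ₀ L
    rw [h2, le_div_iff₀ hℒ₀0]
    exact h1
  have hexp7 : Real.exp u * Real.exp (6 * u) = Real.exp (7 * u) := by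
    rw [← Real.exp_add]; ring_nf
  have hexp9 : Real.exp u * Real.exp (2 * u) * Real.exp (6 * u) = Real.exp (9 * u) := by
    rw [← Real.exp_add, ← Real.exp_add]; ring_nf
  -- the three terms
  have hT1 : 2 * P * A₀ * (C₀ * k ^ 2 + 1) * E * k ^ 6 ≤ 1 / 3 := by
    have h := mnon_absorb (M := 6 * (3 * K + 1) * A₀ * (C₀ + 1)) (n := 9)
      (t := c / 80 * Real.sqrt C₁) (u := u) (by positivity) hu1 (by linarith)
    calc 2 * P * A₀ * (C₀ * k ^ 2 + 1) * E * k ^ 6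
        ≤ 2 * ((3 * K + 1) * Real.exp u) * A₀ * ((C₀ + 1) * Real.exp (2 * u)) *
            Real.exp (-(c / 80 * Real.sqrt C₁ * u)) * Real.exp (6 * u) := by gcongr
      _ = 6 * (3 * K + 1) * A₀ * (C₀ + 1) * Real.exp (9 * u) *
            Real.exp (-(c / 80 * Real.sqrt C₁ * u)) / 3 := by rw [← hexp9]; ring
      _ ≤ 1 / 3 := by gcongr
  have hT2 : 2 * P * k ^ 6 ≤ x / 3 := by
    have h : 6 * (3 * K + 1) * Real.exp (7 * u) ≤ x :=
      mnon_growth (M := 6 * (3 * K + 1)) (n := 7) (by positivity) (by norm_num) hu1 (by linarith) hx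
    calc 2 * P * k ^ 6 ≤ 2 * ((3 * K + 1) * Real.exp u) * Real.exp (6 * u) := by gcongr
      _ = 6 * (3 * K + 1) * Real.exp (7 * u) / 3 := by rw [← hexp7]; ring
      _ ≤ x / 3 := by gcongr
  have hT3 : 4 * P * EL * k ^ 6 ≤ 1 / 3 := by
    have h := mnon_absorb (M := 12 * (3 * K + 1)) (n := 7) (t := cL * C₁ / 3) (u := u)
      (by positivity) hu1 (by linarith)
    calc 4 * P * EL * k ^ 6
        ≤ 4 * ((3 * K + 1) * Real.exp u) * Real.exp (-(cL * C₁ / 3 * u)) * Real.exp (6 * u) := by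
          gcongr
      _ = 12 * (3 * K + 1) * Real.exp (7 * u) * Real.exp (-(cL * C₁ / 3 * u)) / 3 := by
          rw [← hexp7]; ring
      _ ≤ 1 / 3 := by gcongr
  -- assemble
  have hk6pos : 0 < k ^ 6 := by positivity
  rw [le_div_iff₀ hk6pos]
  have hsplit : 2 * P * (A₀ * (C₀ * k ^ 2 + 1) * x * E + 1 + 2 * x * EL) * k ^ 6 =
      x * (2 * P * A₀ * (C₀ * k ^ 2 + 1) * E * k ^ 6) + 2 * P * k ^ 6 +
        x * (4 * P * EL * k ^ 6) := by ring
  rw [hsplit]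
  have h1 : x * (2 * P * A₀ * (C₀ * k ^ 2 + 1) * E * k ^ 6) ≤ x * (1 / 3) :=
    mul_le_mul_of_nonneg_left hT1 hx0.le
  have h3 : x * (4 * P * EL * k ^ 6) ≤ x * (1 / 3) := mul_le_mul_of_nonneg_left hT3 hx0.le
  linarith

/-! ## §2 The analytic core: `Re(w · Mtw Ξ x)` for a non-exceptional `Ξ` -/

/-- **The core estimate.**  There are absolute constants `c_L, c > 0`, `K ≥ 0`, `A₀ > 0`, `C₀ ≥ 0`
such that: if a real character `ψ ≠ 1 mod k` has a real zero `β > 1 − (c_L/2)/log(4k)` of `L(s,ψ)`,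
then for every character `Ξ ≠ ψ mod k`, every `|w| ≤ 1` and every `x ≥ 64` with `log k ≤ √log x`,
`|Re(w Σ_{n ≤ x} Ξ(n)μ(n))| ≤ (K log 4k + 1)(A₀ (C₀k² + 1) x e^{−(c/80)√log x} + 1 + 2x e^{−c_L log x/log 4k})`
(Landau's method `ExcPsiData.exists_psi_bound` for `1 + λ Re(w Ξ(n)) μ(n)`,
`MoebiusTwist.exists_excPsiData_all`; the residue term of a real `Ξ ≠ ψ` is controlled by
Landau's same-level repulsion `DirichletZFR.exists_landau_sameLevel_min_le`). -/
theorem mnon_re_bound :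
    ∃ cL : ℝ, 0 < cL ∧ ∃ c : ℝ, 0 < c ∧ ∃ K : ℝ, 0 ≤ K ∧ ∃ A₀ : ℝ, 0 < A₀ ∧ ∃ C₀ : ℝ, 0 ≤ C₀ ∧
      ∀ (k : ℕ) [NeZero k] (ψ : DirichletCharacter ℂ k), ψ ≠ 1 → ψ ^ 2 = 1 →
        ∀ β : ℝ, 1 - cL / 2 / Real.log (4 * k) < β → ψ.LFunction (β : ℂ) = 0 →
          ∀ Ξ : DirichletCharacter ℂ k, Ξ ≠ ψ → ∀ w : ℂ, ‖w‖ ≤ 1 →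
            ∀ x : ℝ, 64 ≤ x → Real.log k ≤ Real.sqrt (Real.log x) →
              |(w * ∑ n ∈ Finset.Ioc 0 ⌊x⌋₊, Ξ (n : ZMod k) * (μ n : ℂ)).re| ≤
                (K * (Real.log k + Real.log 4) + 1) *
                  (A₀ * (C₀ * (k : ℝ) ^ 2 + 1) * x *
                      Real.exp (-(c / 80 * Real.sqrt (Real.log x))) + 1 +
                    2 * x * Real.exp (-(cL / (Real.log k + Real.log 4) * Real.log x))) := by
  obtain ⟨c, hc, hc2, K, hK, C₀, hC₀, hdata⟩ := MoebiusTwist.exists_excPsiData_all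
  obtain ⟨A₀, hA₀, hpsi⟩ := ExcPsiData.exists_psi_bound hc hc2
  obtain ⟨cL, hcL, hLandau⟩ := DirichletZFR.exists_landau_sameLevel_min_le
  refine ⟨cL, hcL, c, hc, K, hK, A₀, hA₀, C₀, hC₀,
    fun k _ ψ hψ hψ2 β hβ hLβ Ξ hΞ w hw x hx hlogk ↦ ?_⟩
  obtain ⟨β', α, F, hcase, hD⟩ := hdata k Ξ w hw
  have hb := hpsi hD x hx hlogk
  rw [MoebiusTwist.psi_coeff_eq] at hb
  set lam : ℝ := 1 / (K * (Real.log k + Real.log 4) + 1) with hlam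
  set S : ℂ := ∑ n ∈ Finset.Ioc 0 ⌊x⌋₊, Ξ (n : ZMod k) * (μ n : ℂ) with hSdef
  set E : ℝ := Real.exp (-(c / 80 * Real.sqrt (Real.log x))) with hEdef
  set ℒ₀ : ℝ := Real.log k + Real.log 4 with hℒ₀def
  set EL : ℝ := Real.exp (-(cL / ℒ₀ * Real.log x)) with hELdef
  have hE0 : 0 < E := Real.exp_pos _
  have hEL0 : 0 < EL := Real.exp_pos _
  have hx0 : 0 < x := by linarith
  have hx1 : 1 ≤ x := by linarith
  have hk0 : (0 : ℝ) < k := by exact_mod_cast NeZero.pos k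
  have hℒ₀1 : 1 ≤ ℒ₀ := PagePNT.one_le_ell0 k
  have hℒ₀0 : 0 < ℒ₀ := by linarith
  have hden : 0 < K * ℒ₀ + 1 := by positivity
  have hlam0 : 0 < lam := by rw [hlam]; positivity
  -- `|⌊x⌋ − x| ≤ 1`
  have hfloor : |(⌊x⌋₊ : ℝ) - x| ≤ 1 := by
    rw [abs_sub_comm, abs_of_nonneg (sub_nonneg.2 (Nat.floor_le hx0.le))]
    exact (sub_lt_iff_lt_add.2 (by linarith [Nat.lt_floor_add_one x])).le
  -- the residue term: `|α x^{β'}/β'| ≤ 2 x e^{−c_L log x/ℒ₀}` (or `0`)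
  have hexc : |α * x ^ β' / β'| ≤ 2 * x * EL := by
    rcases hcase with hα0 | ⟨hΞ1, hΞ2, hβ'⟩
    · rw [hα0, zero_mul, zero_div, abs_zero]; positivity
    · have hβhalf := hD.β_ge
      have hβpos : 0 < β' := by linarith
      have hxβ : 0 < x ^ β' := Real.rpow_pos_of_pos hx0 β'
      -- Landau: `β' ≤ 1 − c_L/ℒ₀`
      have hlog4k : Real.log (4 * k) = ℒ₀ := by
        rw [Real.log_mul (by norm_num) hk0.ne', add_comm, ← hℒ₀def]
      have hmin : min β' β ≤ 1 - cL / ℒ₀ := by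
        have h := hLandau k Ξ ψ hΞ1 hψ hΞ2 hψ2 hΞ β' β hβ' hLβ
        rwa [← hℒ₀def] at h
      have hβ'le : β' ≤ 1 - cL / ℒ₀ := by
        rcases min_le_iff.1 hmin with h | h
        · exact h
        · exfalso
          rw [hlog4k] at hβ
          have : cL / 2 / ℒ₀ ≤ cL / ℒ₀ :=
            div_le_div_of_nonneg_right (by linarith) hℒ₀0.le
          linarith
      have hxβ' : x ^ β' ≤ x * EL := by
        calc x ^ β' ≤ x ^ (1 - cL / ℒ₀) := Real.rpow_le_rpow_of_exponent_le hx1 hβ'le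
          _ = x * EL := by
              rw [Real.rpow_def_of_pos hx0, hELdef]
              calc Real.exp (Real.log x * (1 - cL / ℒ₀))
                  = Real.exp (Real.log x + -(cL / ℒ₀ * Real.log x)) := by ring_nf
                _ = x * Real.exp (-(cL / ℒ₀ * Real.log x)) := by
                    rw [Real.exp_add, Real.exp_log hx0]
      rw [abs_div, abs_mul, abs_of_pos hβpos, abs_of_pos hxβ, div_le_iff₀ hβpos]
      calc |α| * x ^ β' ≤ 1 * (x * EL) := mul_le_mul hD.α_le hxβ' hxβ.le zero_le_one
        _ ≤ 2 * x * EL * β' := by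
            rw [one_mul]
            have : 0 ≤ x * EL := by positivity
            nlinarith
  -- `λ |Re(wS)| ≤ main + 1 + residue`
  have hkey : lam * |(w * S).re| ≤ A₀ * (C₀ * (k : ℝ) ^ 2 + 1) * x * E + 1 + 2 * x * EL := by
    have heq : lam * (w * S).re = ((⌊x⌋₊ : ℝ) + lam * (w * S).re - (x - α * x ^ β' / β')) +
        (x - (⌊x⌋₊ : ℝ)) - α * x ^ β' / β' := by ring
    rw [← abs_of_pos hlam0, ← abs_mul, heq]
    calc |((⌊x⌋₊ : ℝ) + lam * (w * S).re - (x - α * x ^ β' / β')) + (x - (⌊x⌋₊ : ℝ)) -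
          α * x ^ β' / β'|
        ≤ |((⌊x⌋₊ : ℝ) + lam * (w * S).re - (x - α * x ^ β' / β')) + (x - (⌊x⌋₊ : ℝ))| +
            |α * x ^ β' / β'| := abs_sub _ _
      _ ≤ (|(⌊x⌋₊ : ℝ) + lam * (w * S).re - (x - α * x ^ β' / β')| + |x - (⌊x⌋₊ : ℝ)|) +
            |α * x ^ β' / β'| := add_le_add (abs_add_le _ _) le_rfl
      _ ≤ (A₀ * (C₀ * (k : ℝ) ^ 2 + 1) * x * E + 1) + 2 * x * EL := by
          refine add_le_add (add_le_add hb ?_) hexc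
          rw [abs_sub_comm]; exact hfloor
  -- divide by `λ`
  calc |(w * S).re| = (K * ℒ₀ + 1) * (lam * |(w * S).re|) := by rw [hlam]; field_simp
    _ ≤ (K * ℒ₀ + 1) * (A₀ * (C₀ * (k : ℝ) ^ 2 + 1) * x * E + 1 + 2 * x * EL) :=
        mul_le_mul_of_nonneg_left hkey hden.le

/-! ## §3 The law -/

/-- **The non-exceptional-character Möbius law** (stub B of the mirror line): there are absolute
`c₁, C₁ > 0` with `MoebiusNonexcLaw c₁ C₁` — if a real character `ψ ≠ 1 mod k` owns a real zero
`β ∈ (1 − c₁/log(4k), 1)` of `L(s, ψ)`, then every other character `Ξ ≠ ψ mod k` satisfies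
`‖Mtw Ξ x‖ ≤ x/k⁶` for all `x ≥ exp(C₁ (1 + log k)²)`.  Proof: `mnon_re_bound` with `w = 1` and
`w = −i` bounds `|Re Mtw|` and `|Im Mtw|`; `mnon_constants` chooses `C₁`. -/
theorem moebiusNonexcLaw : ∃ c₁ C₁ : ℝ, 0 < c₁ ∧ 0 < C₁ ∧ MoebiusNonexcLaw c₁ C₁ := by
  obtain ⟨cL, hcL, c, hc, K, hK, A₀, hA₀, C₀, hC₀, hre⟩ := mnon_re_bound
  obtain ⟨C₁, hC₁, hconst⟩ := mnon_constants hc hcL hK hA₀.le hC₀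
  refine ⟨cL / 2, C₁, by positivity, hC₁, ?_⟩
  intro k _ ψ hψ hψ2 β hβ _hβ1 hLβ Ξ hΞ x hx
  have hk1 : (1 : ℝ) ≤ k := by exact_mod_cast NeZero.one_le
  obtain ⟨hx64, hlogk, hB⟩ := hconst k hk1 x hx
  set S : ℂ := ∑ n ∈ Finset.Ioc 0 ⌊x⌋₊, Ξ (n : ZMod k) * (μ n : ℂ) with hSdef
  have hsumS : Mtw Ξ x = S := by
    rw [Mtw]
    have hIcc : Finset.Icc 1 ⌊x⌋₊ = Finset.Ioc 0 ⌊x⌋₊ := rfl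
    rw [hIcc, hSdef]
    exact Finset.sum_congr rfl fun n _ ↦ mul_comm _ _
  have hB1 := hre k ψ hψ hψ2 β hβ hLβ Ξ hΞ 1 (by simp) x hx64 hlogk
  have hB2 := hre k ψ hψ hψ2 β hβ hLβ Ξ hΞ (-I) (by simp) x hx64 hlogk
  rw [one_mul] at hB1
  have hre2 : (-I * S).re = S.im := by simp
  rw [hre2] at hB2
  rw [hsumS]
  calc ‖S‖ ≤ |S.re| + |S.im| := Complex.norm_le_abs_re_add_abs_im S
    _ ≤ (K * (Real.log k + Real.log 4) + 1) *
          (A₀ * (C₀ * (k : ℝ) ^ 2 + 1) * x * Real.exp (-(c / 80 * Real.sqrt (Real.log x))) + 1 +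
            2 * x * Real.exp (-(cL / (Real.log k + Real.log 4) * Real.log x))) +
        (K * (Real.log k + Real.log 4) + 1) *
          (A₀ * (C₀ * (k : ℝ) ^ 2 + 1) * x * Real.exp (-(c / 80 * Real.sqrt (Real.log x))) + 1 +
            2 * x * Real.exp (-(cL / (Real.log k + Real.log 4) * Real.log x))) :=
        add_le_add hB1 hB2
    _ = 2 * (K * (Real.log k + Real.log 4) + 1) *
          (A₀ * (C₀ * (k : ℝ) ^ 2 + 1) * x * Real.exp (-(c / 80 * Real.sqrt (Real.log x))) + 1 +
            2 * x * Real.exp (-(cL / (Real.log k + Real.log 4) * Real.log x))) := by ring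
    _ ≤ x / (k : ℝ) ^ 6 := hB

end Summit.Parity.GeneralizedHardyLittlewood.Theorems.DilatedChowla.Negative

end
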